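import Literature.Analysis.Complex.GraphContourDeformationFirstCoord
import Literature.Analysis.Complex.GraphContourDeformationLocal
import HarnessLib

/-!
# Deformation of `ℝ^{n+1}` into a graph along the first coordinate, localised

Topic `Literature/Analysis/Complex`. The localised companion of
`GraphContourDeformationFirstCoord.lean`: the sweep hypothesis is required only over an open
**convex** set `U₀ ⊆ ℝ^{n+1}` containing the support of the profile `φ` (nothing is assumed at the
other real points, where the profile vanishes and the contour is not moved):

  `∫ w, ((1 + i ∂₀φ(w)) • Ψ(cx w + iφ(w)e₀) - Ψ(cx w)) = 0`
  (`integral_graph_deformation_firstCoord_sub_eq_zero`).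

Proof: Fubini along the first axis as in the global version; on the line `t ↦ (t, ω)` the trace
of `U₀` is an open interval containing the compact trace of `tsupport φ`, so the localised
one-variable theorem `integral_graph_deformation_sub_eq_zero` applies on a closed interval
`[a, b]` between them; lines missing the support contribute `0`.

## References

* Z. Grujić, I. Kukavica, J. Funct. Anal. 152 (1998), §2. [GrujicKukavica1998]
* Z. Bradshaw, Z. Grujić, I. Kukavica, J. Differential Equations 259 (2015), §3. [BradshawGrujicKukavica2015]
-/

noncomputable section

open MeasureTheory Set Function Filter Metric
open _root_.Topology
open _root_.Complex (I)
open Literature.Analysis.FunctionSpaces.EuclideanSpace (complexify complexify_apply)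

namespace Literature.Analysis.Complex

variable {G : Type*} [NormedAddCommGroup G] [NormedSpace ℂ G] [CompleteSpace G]

/-- **An interval between a compact set and an open convex set of reals**: if `K ⊆ V ⊆ ℝ` with
`K` compact non-empty and `V` open and convex, there are `a ≤ b` with `K ⊆ (a, b)` and
`[a, b] ⊆ V`. [folklore] -/
theorem exists_Icc_between_of_convex {K V : Set ℝ} (hK : IsCompact K) (hKne : K.Nonempty)
    (hV : IsOpen V) (hVc : Convex ℝ V) (hKV : K ⊆ V) :
    ∃ a b : ℝ, a ≤ b ∧ K ⊆ Ioo a b ∧ Icc a b ⊆ V := by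
  have hbdd_b := hK.bddBelow
  have hbdd_a := hK.bddAbove
  have hinf : sInf K ∈ K := hK.sInf_mem hKne
  have hsup : sSup K ∈ K := hK.sSup_mem hKne
  have hle : sInf K ≤ sSup K := le_csSup hbdd_a hinf
  have hord : V.OrdConnected := convex_iff_ordConnected.1 hVc
  have hseg : Icc (sInf K) (sSup K) ⊆ V := hord.out (hKV hinf) (hKV hsup)
  obtain ⟨δ, hδ, hδV⟩ := (isCompact_Icc (a := sInf K) (b := sSup K)).exists_cthickening_subset_open hV hseg
  refine ⟨sInf K - δ, sSup K + δ, by linarith, fun x hx => ?_, fun x hx => hδV ?_⟩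
  · exact ⟨by linarith [csInf_le hbdd_b hx], by linarith [le_csSup hbdd_a hx]⟩
  · rcases le_total x (sInf K) with h1 | h1
    · refine Metric.mem_cthickening_of_dist_le x (sInf K) δ _ (left_mem_Icc.2 hle) ?_
      rw [Real.dist_eq, abs_of_nonpos (by linarith)]
      linarith [hx.1]
    · rcases le_total x (sSup K) with h2 | h2
      · exact Metric.mem_cthickening_of_dist_le x x δ _ ⟨h1, h2⟩ (by rw [dist_self]; exact hδ.le)
      · refine Metric.mem_cthickening_of_dist_le x (sSup K) δ _ (right_mem_Icc.2 hle) ?_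
        rw [Real.dist_eq, abs_of_nonneg (by linarith)]
        linarith [hx.2]

/-- **Deformation of `ℝ^{n+1}` into a graph along the first coordinate, localised.** Let
`Ψ : ℂ^{n+1} → G` be holomorphic on an open `U`, `φ : ℝ^{n+1} → ℝ` of class `C¹` with compact
support contained in an open convex `U₀`, and assume the graphs `cx w + iθφ(w) e₀`, `0 ≤ θ ≤ 1`,
over `w ∈ U₀` lie in `U`. If the difference of the two integrands is integrable, then
`∫ w, ((1 + i ∂₀φ(w)) • Ψ(cx w + iφ(w)e₀) - Ψ(cx w)) = 0`. [folklore] -/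
theorem integral_graph_deformation_firstCoord_sub_eq_zero {n : ℕ}
    {Ψ : EuclideanSpace ℂ (Fin (n + 1)) → G}
    {U : Set (EuclideanSpace ℂ (Fin (n + 1)))} (hU : IsOpen U) (hΨ : DifferentiableOn ℂ Ψ U)
    {φ : EuclideanSpace ℝ (Fin (n + 1)) → ℝ} (hφ : ContDiff ℝ 1 φ) (hφc : HasCompactSupport φ)
    {U₀ : Set (EuclideanSpace ℝ (Fin (n + 1)))} (hU₀ : IsOpen U₀) (hU₀c : Convex ℝ U₀)
    (hsupp : tsupport φ ⊆ U₀)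
    (hsweep : ∀ w ∈ U₀, ∀ θ ∈ Icc (0 : ℝ) 1,
      complexify w +
        I • complexify ((θ * φ w) • EuclideanSpace.single (0 : Fin (n + 1)) (1 : ℝ)) ∈ U)
    (hint : Integrable fun w : EuclideanSpace ℝ (Fin (n + 1)) =>
      ((1 : ℂ) + I * ((fderiv ℝ φ w (EuclideanSpace.single 0 1) : ℝ) : ℂ)) •
        Ψ (complexify w + I • complexify (φ w • EuclideanSpace.single (0 : Fin (n + 1)) (1 : ℝ))) -
        Ψ (complexify w)) :
    ∫ w : EuclideanSpace ℝ (Fin (n + 1)),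
        (((1 : ℂ) + I * ((fderiv ℝ φ w (EuclideanSpace.single 0 1) : ℝ) : ℂ)) •
          Ψ (complexify w +
            I • complexify (φ w • EuclideanSpace.single (0 : Fin (n + 1)) (1 : ℝ))) -
          Ψ (complexify w)) = 0 := by
  -- split off the first coordinate
  set e : EuclideanSpace ℝ (Fin (n + 1)) ≃ᵐ ℝ × (Fin n → ℝ) :=
    (MeasurableEquiv.toLp 2 (Fin (n + 1) → ℝ)).symm.trans
      (MeasurableEquiv.piFinSuccAbove (fun _ => ℝ) 0) with he
  have hmp : MeasurePreserving e volume volume :=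
    (EuclideanSpace.volume_preserving_symm_measurableEquiv_toLp (Fin (n + 1))).trans
      (volume_preserving_piFinSuccAbove (fun _ => ℝ) 0)
  have hsymm : ∀ (t : ℝ) (ω : Fin n → ℝ),
      e.symm (t, ω) = (WithLp.toLp 2 (Fin.cons t ω : Fin (n + 1) → ℝ)) := by
    intro t ω
    apply e.injective
    rw [MeasurableEquiv.apply_symm_apply]
    simp [he, MeasurableEquiv.trans_apply, MeasurableEquiv.piFinSuccAbove_apply, Fin.cons_zero]
  set D : EuclideanSpace ℝ (Fin (n + 1)) → G := fun w =>
    ((1 : ℂ) + I * ((fderiv ℝ φ w (EuclideanSpace.single 0 1) : ℝ) : ℂ)) •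
      Ψ (complexify w + I • complexify (φ w • EuclideanSpace.single (0 : Fin (n + 1)) (1 : ℝ))) -
      Ψ (complexify w) with hD
  have hD' : Integrable (D ∘ e.symm) (volume : Measure (ℝ × (Fin n → ℝ))) :=
    hmp.symm.integrable_comp_emb e.symm.measurableEmbedding |>.2 hint
  have htrans : ∫ w, D w = ∫ q : ℝ × (Fin n → ℝ), D (e.symm q) :=
    (hmp.symm.integral_comp e.symm.measurableEmbedding D).symm
  have hprod : ∫ q : ℝ × (Fin n → ℝ), D (e.symm q) = ∫ ω : Fin n → ℝ, ∫ t : ℝ, D (e.symm (t, ω)) :=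
    integral_prod_symm (fun q : ℝ × (Fin n → ℝ) => D (e.symm q)) hD'
  rw [show (∫ w, (((1 : ℂ) + I * ((fderiv ℝ φ w (EuclideanSpace.single 0 1) : ℝ) : ℂ)) •
      Ψ (complexify w + I • complexify (φ w • EuclideanSpace.single (0 : Fin (n + 1)) (1 : ℝ))) -
      Ψ (complexify w))) = ∫ w, D w from rfl, htrans, hprod]
  refine integral_eq_zero_of_ae (Eventually.of_forall fun ω => ?_)
  -- the line through `ω`
  have hgd : Differentiable ℝ φ := hφ.differentiable (by simp)
  set ℓ : ℝ → EuclideanSpace ℝ (Fin (n + 1)) := fun t =>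
    (WithLp.toLp 2 (Fin.cons t ω : Fin (n + 1) → ℝ)) with hℓ
  set g : ℝ → ℝ := fun t => φ (ℓ t) with hg
  set F : ℂ → G := fun ζ => Ψ (WithLp.toLp 2 (Fin.cons ζ (fun j => (ω j : ℂ)) : Fin (n + 1) → ℂ))
    with hF
  have hline : ∀ t, HasDerivAt ℓ (EuclideanSpace.single (0 : Fin (n + 1)) (1 : ℝ)) t :=
    hasDerivAt_toLp_cons ω
  have hℓc : Continuous ℓ := continuous_iff_continuousAt.2 fun t => (hline t).continuousAt
  have hgderiv : ∀ t, deriv g t = fderiv ℝ φ (ℓ t) (EuclideanSpace.single 0 1) := by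
    intro t
    have h := ((hgd _).hasFDerivAt).comp_hasDerivAt t (hline t)
    exact h.deriv
  have hℓaff : ℓ = fun t => t • EuclideanSpace.single (0 : Fin (n + 1)) (1 : ℝ) +
      (WithLp.toLp 2 (Fin.cons 0 ω : Fin (n + 1) → ℝ) : EuclideanSpace ℝ (Fin (n + 1))) := by
    funext t; ext i; refine Fin.cases ?_ (fun j => ?_) i
    · simp [hℓ]
    · simp [hℓ, Fin.succ_ne_zero]
  have hgC : ContDiff ℝ 1 g := by
    rw [hg, hℓaff]
    exact hφ.comp (by fun_prop)
  have hiso : Isometry ℓ := by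
    refine Isometry.of_dist_eq fun t t' => ?_
    rw [hℓ, EuclideanSpace.dist_eq, Fin.sum_univ_succ]
    simp [Real.dist_eq, Real.sqrt_sq_eq_abs]
  -- the identification of the line integrand
  have hDt : ∀ t, D (e.symm (t, ω)) = ((1 : ℂ) + I * ((deriv g t : ℝ) : ℂ)) •
      F ((t : ℂ) + I * ((g t : ℝ) : ℂ)) - F (t : ℂ) := by
    intro t
    rw [hsymm, hgderiv]
    simp only [hD, hF, hg, hℓ]
    rw [complexify_cons_add_I_smul_single, complexify_cons]
  simp only [hDt]
  -- the traces on the line of the support and of `U₀`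
  set K : Set ℝ := ℓ ⁻¹' tsupport φ with hK
  have hKc : IsCompact K := hiso.isClosedEmbedding.isCompact_preimage hφc
  have htsg : tsupport g ⊆ K :=
    closure_minimal (fun t ht => subset_tsupport φ (by simpa [hg] using ht))
      ((isClosed_tsupport φ).preimage hℓc)
  by_cases hKne : K.Nonempty
  · set V : Set ℝ := ℓ ⁻¹' U₀ with hV
    have hVopen : IsOpen V := hU₀.preimage hℓc
    have hVc : Convex ℝ V := by
      intro t₁ h₁ t₂ h₂ a b ha hb hab
      show ℓ (a • t₁ + b • t₂) ∈ U₀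
      have e : ℓ (a • t₁ + b • t₂) = a • ℓ t₁ + b • ℓ t₂ := by
        set p₀ : EuclideanSpace ℝ (Fin (n + 1)) :=
          (WithLp.toLp 2 (Fin.cons 0 ω : Fin (n + 1) → ℝ) : EuclideanSpace ℝ (Fin (n + 1))) with hp₀
        set e₀ : EuclideanSpace ℝ (Fin (n + 1)) := EuclideanSpace.single (0 : Fin (n + 1)) (1 : ℝ) with he₀
        have hp : a • p₀ + b • p₀ = p₀ := by rw [← add_smul, hab, one_smul]
        rw [hℓaff]
        show (a • t₁ + b • t₂) • e₀ + p₀ = a • (t₁ • e₀ + p₀) + b • (t₂ • e₀ + p₀)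
        calc (a • t₁ + b • t₂) • e₀ + p₀ = (a • t₁ + b • t₂) • e₀ + (a • p₀ + b • p₀) := by rw [hp]
          _ = a • (t₁ • e₀ + p₀) + b • (t₂ • e₀ + p₀) := by
              simp only [add_smul, smul_add, smul_smul, smul_eq_mul]
              abel
      rw [e]
      exact hU₀c h₁ h₂ ha hb hab
    obtain ⟨a, b, hab, hKab, hIccV⟩ := exists_Icc_between_of_convex hKc hKne hVopen hVc
      (preimage_mono hsupp)
    -- the complex line and the one-variable theorem
    set W : Set ℂ := {ζ | (WithLp.toLp 2 (Fin.cons ζ (fun j => (ω j : ℂ)) : Fin (n + 1) → ℂ) :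
        EuclideanSpace ℂ (Fin (n + 1))) ∈ U} with hW
    have hWopen : IsOpen W := hU.preimage (differentiable_toLp_cons ω).continuous
    have hFdiff : DifferentiableOn ℂ F W := hΨ.comp (differentiable_toLp_cons ω).differentiableOn
      fun ζ hζ => hζ
    have hsweepW : ∀ t ∈ Icc a b, ∀ θ ∈ Icc (0 : ℝ) 1, ((t : ℂ) + I * ((θ * g t : ℝ) : ℂ)) ∈ W := by
      intro t ht θ hθ
      have h := hsweep (ℓ t) (hIccV ht) θ hθ
      rwa [hℓ, complexify_cons_add_I_smul_single] at h
    exact integral_graph_deformation_sub_eq_zero hWopen hFdiff hgC hab (htsg.trans hKab) hsweepW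
  · -- the line misses the support: the integrand vanishes identically
    have hg0 : ∀ t, t ∉ tsupport g := fun t ht => hKne ⟨t, htsg ht⟩
    have : ∀ t, ((1 : ℂ) + I * ((deriv g t : ℝ) : ℂ)) • F ((t : ℂ) + I * ((g t : ℝ) : ℂ)) - F (t : ℂ) = 0 := by
      intro t
      simp only [image_eq_zero_of_notMem_tsupport (hg0 t), deriv_eq_zero_of_notMem_tsupport (hg0 t),
        mul_zero, Complex.ofReal_zero, add_zero, one_smul, sub_self]
    simp only [this, MeasureTheory.integral_zero, Pi.zero_apply]

end Literature.Analysis.Complex
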